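import Summits.CriticalPhenomena.Ising3DConformalLimit.Theorems.HyperoctahedralRPExistsScaleCovariantLimitSplitGlue
import Summits.CriticalPhenomena.Ising3DConformalLimit.Theorems.MoebiusLimitExists.Negative.MeshContinuity
import HarnessLib

/-!
# Standalone split glue — crux `ExistsContinuousLimit` (item stmt-CriticalPhenomena-4582) ⟸ item 6150 ∧ item 4659,
# in a module importing NEITHER route file that owns the crux (`ReflectionTwin`, `LogPolarProxy`)

Crux-strategist s1 (2026-08-17), decomposition output (D-0019 glued split, planner protocol (b)).

The crux `ReflectionTwin.ExistsContinuousLimit` (= `LogPolarProxy.ExistsContinuousLimit`, one term) is EQUIVALENT to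
item 6150 `MirrorHoelderCompactness.TwoPointDoubling` ∧ item 4659 `ClusterRigidity.ClusterSetTotallyDisconnected`
(landed: `LogPolarProxyExistsContinuousLimit.reflectionTwin_existsContinuousLimit_iff_doubling_and_totallyDisconnected`,
p149785 = p146967 ∘ p139907). That landed glue lives in a module importing `Theses.ReflectionTwin` and `Theses.LogPolarProxy`,
so it cannot be cited as `route edit --split … --glue-by` on either route (the gate imports the glue module INTO the route
file: cyclic import). This file states the closing direction with the crux's BODY as conclusion (the eight clauses, verbatim
term of both route decls, accepted at each copy by `δ`-unfolding — the device of
`Theorems/HyperoctahedralRPExistsScaleCovariantLimitSplitGlue.lean` for the sibling crux 1981) and imports only the 1981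
standalone glue (cone: `HyperoctahedralRP`, `MirrorHoelderCompactness`, `ClusterRigidity`, `MonotoneRG`) and mesh continuity
(cone: `EnergyNotSigmaSquared`). Proof: `hrp_crux_of_doubling_of_totallyDisconnected` gives the seven clauses of
`HyperoctahedralRP.ExistsScaleCovariantLimit`; the eighth (continuity of every `S n` on `NonCoincident 3 n`) is
`LimitMeshContinuity.continuousOn_limit`, unconditional for any pointwise scaling limit of `criticalCorr 3`.

References: H. Duminil-Copin, ICM 2022, §8.4 [DuminilCopinICM2022]; M. Aizenman, H. Duminil-Copin, Ann. of Math. 194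
(2021), arXiv:1912.07973, Remark 5.10 [AizenmanDuminilCopinAnnals2021].
-/

noncomputable section

namespace Summit.CriticalPhenomena.Ising3DConformalLimit.Cruxes.ExistsContinuousLimit.SplitGlue

open Literature.Probability.LatticeModels
open Summit.CriticalPhenomena.Ising3DConformalLimit.Theses
open Summit.CriticalPhenomena.Ising3DConformalLimit.Cruxes.ExistsScaleCovariantLimit.SplitGlue
  (hrp_crux_of_doubling_of_totallyDisconnected)
open Summit.CriticalPhenomena.Ising3DConformalLimit.LimitMeshContinuity (continuousOn_limit)

/-- **Curried split glue for crux 4582, route-file-free**: item 6150 `TwoPointDoubling` and item 4659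
`ClusterSetTotallyDisconnected` imply the body of `ReflectionTwin.ExistsContinuousLimit` /
`LogPolarProxy.ExistsContinuousLimit` — the continuous, normalised, non-degenerate, translation-invariant,
scale-covariant full pointwise scaling limit of the critical `ℤ³` Ising correlators. [folklore] -/
theorem ExistsContinuousLimit_of_subs :
    Summit.CriticalPhenomena.Ising3DConformalLimit.Theses.MirrorHoelderCompactness.TwoPointDoubling →
      Summit.CriticalPhenomena.Ising3DConformalLimit.Theses.ClusterRigidity.ClusterSetTotallyDisconnected →
        ∃ (ρ : ℝ → ℝ) (Δ : ℝ) (S : Literature.Probability.LatticeModels.CorrFamily 3),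
          (∀ δ ∈ Set.Ioc (0:ℝ) 1, 0 < ρ δ) ∧ 0 < Δ ∧
            Literature.Probability.LatticeModels.HasPointwiseScalingLimit
                (Literature.Probability.LatticeModels.criticalCorr 3) ρ S ∧
              (∀ n z, z ∉ Literature.Probability.LatticeModels.NonCoincident 3 n → S n z = 0) ∧
                (∀ n, ContinuousOn (S n) (Literature.Probability.LatticeModels.NonCoincident 3 n)) ∧
                  Literature.Probability.LatticeModels.IsNondegenerateTwoPoint S ∧
                    Literature.Probability.LatticeModels.IsTranslationInvariant S ∧
                      Literature.Probability.LatticeModels.IsScaleCovariant Δ S := by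
  intro hD hT
  obtain ⟨ρ, Δ, S, hρ, hΔ, hlim, hnorm, hnd, htr, hsc⟩ := hrp_crux_of_doubling_of_totallyDisconnected hD hT
  exact ⟨ρ, Δ, S, hρ, hΔ, hlim, hnorm, fun n => continuousOn_limit hlim n, hnd, htr, hsc⟩

end Summit.CriticalPhenomena.Ising3DConformalLimit.Cruxes.ExistsContinuousLimit.SplitGlue

end
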